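import Mathlib
import Literature.Computability.AlgebraicComplexity.ArithCircuitProofs
import Literature.Computability.AlgebraicComplexity.MatMulTotalComplexityProofs
import Literature.Computability.AlgebraicComplexity.FastFourierTransform
import Literature.LinearAlgebra.Matrix.CauchyDeterminant
import Literature.Computability.AlgebraicComplexity.DivisionSLP
import Literature.LinearAlgebra.Matrix.CauchyLike

/-!
# Stub `stub_polyMulCost` of crux `HiddenToeplitzCorners.ToeplitzLikeDetCost` (stmt-MatrixMultiplication-7491),
# line `Sketch`

Cost of a polynomial product via the tree's `fastNconv` (K-level).

Target tree file: `Summits/MatrixMultiplication/MatrixMultiplication/Theorems/HiddenToeplitzCornersToeplitzLikeDetCostPolyMulCost.lean`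
(helper for the crux, landed with `--supports stmt-MatrixMultiplication-7491`). The theorem `stub_polyMulCost`
below must keep EXACTLY this name and signature (it is registered on the crux).
-/

set_option linter.dupNamespace false

namespace Summit.MatrixMultiplication.MatrixMultiplication.Theorems

open scoped BigOperators Matrix
open Literature.Computability.AlgebraicComplexity Literature.LinearAlgebra.Matrix
open Literature.Computability.AlgebraicComplexity.ArithCircuit (FanInTwoSeq freeInputs)

noncomputable section

section KLevel
variable {K : Type} [Field K] [Algebra ℂ K]

/-! ### Helpers for `stub_polyMulCost` -/

/-- Reading the double sum `∑_{i, j < n} [i + j = m] u_i v_j` over `Fin n × Fin n` through the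
zero-extended coefficient sequences on `ℕ`. [folklore] -/
theorem polyMulCost_sum_fin_eq {R : Type*} [CommRing R] (n : ℕ) (u v : Fin n → R) (a b : ℕ → R)
    (hau : ∀ i : Fin n, a i = u i) (hbv : ∀ j : Fin n, b j = v j) (m : ℕ) :
    (∑ i : Fin n, ∑ j : Fin n, if (i : ℕ) + j = m then u i * v j else 0) =
      ∑ i ∈ Finset.range n, ∑ j ∈ Finset.range n, if i + j = m then a i * b j else 0 := by
  rw [← Fin.sum_univ_eq_sum_range]
  refine Finset.sum_congr rfl fun i _ => ?_
  rw [← Fin.sum_univ_eq_sum_range]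
  refine Finset.sum_congr rfl fun j _ => ?_
  rw [hau, hbv]

/-- **No wrap-around**: if `a` and `b` vanish from index `n` on and `2 n ≤ t`, then the `m`-th
coefficient `∑_{i + j = m} a_i b_j` of the plain product equals the negacyclic convolution
`nconv t a b m` — the product has degree `< 2 n ≤ t`, so reducing modulo `y ^ t + 1` does nothing.
[folklore] -/
theorem polyMulCost_coeff_eq_nconv {R : Type*} [CommRing R] {n t : ℕ} (hnt : 2 * n ≤ t)
    (a b : ℕ → R) (ha0 : ∀ i, n ≤ i → a i = 0) (hb0 : ∀ i, n ≤ i → b i = 0) (m : ℕ) :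
    (∑ i ∈ Finset.range n, ∑ j ∈ Finset.range n, if i + j = m then a i * b j else 0) =
      nconv t a b m := by
  -- the wrapped part of `nconv` vanishes termwise
  have hwrap : ∑ i ∈ Finset.Ico (m + 1) t, a i * b (m + t - i) = 0 := by
    refine Finset.sum_eq_zero fun i hi => ?_
    obtain ⟨-, hit⟩ := Finset.mem_Ico.1 hi
    rcases Nat.lt_or_ge i n with hin | hin
    · rw [hb0 _ (by omega), mul_zero]
    · rw [ha0 _ hin, zero_mul]
  rw [nconv, hwrap, sub_zero]
  -- the inner sum has at most one nonzero term, at `j = m - i`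
  have hinner : ∀ i, (∑ j ∈ Finset.range n, if i + j = m then a i * b j else 0) =
      if i ≤ m then a i * b (m - i) else 0 := by
    intro i
    split_ifs with him
    · rw [Finset.sum_eq_single (m - i), if_pos (by omega)]
      · intro j _ hj
        exact if_neg (by omega)
      · intro hj
        rw [hb0 _ (by rw [Finset.mem_range] at hj; omega), mul_zero, ite_self]
    · exact Finset.sum_eq_zero fun j _ => if_neg (by omega)
  simp_rw [hinner]
  -- both sides are sums of `g i = [i ≤ m] a i * b (m - i)` over ranges containing its support
  have hbig1 : (∑ i ∈ Finset.range n, if i ≤ m then a i * b (m - i) else 0) =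
      ∑ i ∈ Finset.range (n + (m + 1)), if i ≤ m then a i * b (m - i) else 0 :=
    Finset.sum_subset (Finset.range_subset_range.2 (by omega)) fun i _ hi => by
      rw [ha0 i (by rw [Finset.mem_range] at hi; omega), zero_mul, ite_self]
  have hbig2 : (∑ i ∈ Finset.range (m + 1), a i * b (m - i)) =
      ∑ i ∈ Finset.range (n + (m + 1)), if i ≤ m then a i * b (m - i) else 0 :=
    calc (∑ i ∈ Finset.range (m + 1), a i * b (m - i))
        = ∑ i ∈ Finset.range (m + 1), if i ≤ m then a i * b (m - i) else 0 :=
          Finset.sum_congr rfl fun i hi => (if_pos (by rw [Finset.mem_range] at hi; omega)).symm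
      _ = ∑ i ∈ Finset.range (n + (m + 1)), if i ≤ m then a i * b (m - i) else 0 :=
          Finset.sum_subset (Finset.range_subset_range.2 (by omega)) fun i _ hi =>
            if_neg (by rw [Finset.mem_range] at hi; omega)
  rw [hbig1, hbig2]

/-- A family `f i`, `i < t`, each member of which costs one step from `A`, costs at most `t` steps
in total (one computation sequence; `Derivable.biUnion` over `range t`). [folklore] -/
theorem polyMulCost_family {t : ℕ} {A : Set K} {f : ℕ → K}
    (h : ∀ i < t, Derivable ℂ 1 A {f i}) : Derivable ℂ t A {v | ∃ i < t, v = f i} := by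
  have h' := Derivable.biUnion (k := ℂ) (Finset.range t) (c := fun _ => 1) (A := A)
    (B := fun i => ({f i} : Set K)) (fun i hi => h i (Finset.mem_range.1 hi))
  refine h'.mono (by simp) le_rfl ?_
  rintro v ⟨i, hi, rfl⟩
  exact Set.mem_biUnion (Finset.mem_range.2 hi) rfl

/-- **Cost of the fast negacyclic convolution** (GG Algorithm 8.16 inside step 3 of Algorithm 8.20;
the cost half of GG Thm 8.22 in the `Derivable` model, constants free): granted that a radix-2 FFT
of length `2^k` costs `k 2^k` steps (`hfft`), all `2^k` outputs of the tree's
`fastNconv k η tinv a b` (with constant `η`, `tinv`) are derivable from the inputs `a i`, `b i`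
(`i < 2^k`) in `(3k + 4) 2^k` steps: `2 · 2^k` weightings `η^i a_i`, `η^i b_i`, two forward FFTs,
`2^k` pointwise products, one backward FFT, `2^k` unweightings-and-scalings.
[cite: GathenGerhard2013, §8.3 Thm 8.22] -/
theorem polyMulCost_fastNconvCost (hfft : ∀ (κ : ℕ) (ω : ℂ) (a : ℕ → K) (A : Set K),
      (∀ i < 2 ^ κ, a i ∈ A ∪ Set.range (algebraMap ℂ K)) →
      Derivable ℂ (κ * 2 ^ κ) A {v | ∃ j < 2 ^ κ, v = fft κ (algebraMap ℂ K ω) a j})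
    (k : ℕ) (η c : ℂ) (a b : ℕ → K) (A : Set K)
    (ha : ∀ i < 2 ^ k, a i ∈ A ∪ Set.range (algebraMap ℂ K))
    (hb : ∀ i < 2 ^ k, b i ∈ A ∪ Set.range (algebraMap ℂ K)) :
    Derivable ℂ ((3 * k + 4) * 2 ^ k) A
      {w | ∃ m < 2 ^ k, w = fastNconv k (algebraMap ℂ K η) (algebraMap ℂ K c) a b m} := by
  -- the weighted inputs and the pointwise products of their transforms
  set wa : ℕ → K := fun i => algebraMap ℂ K η ^ i * a i with hwa
  set wb : ℕ → K := fun i => algebraMap ℂ K η ^ i * b i with hwb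
  set P : ℕ → K := fun l => fft k (algebraMap ℂ K η * algebraMap ℂ K η) wa l *
    fft k (algebraMap ℂ K η * algebraMap ℂ K η) wb l with hP
  -- stage 1: the weightings, `2^k + 2^k` linear steps
  have h1a : Derivable ℂ (2 ^ k) A {v | ∃ i < 2 ^ k, v = wa i} := by
    refine polyMulCost_family fun i hi => ?_
    have h := Derivable.smul (k := ℂ) (A := A) (ha i hi) (η ^ i)
    rwa [Algebra.smul_def, map_pow] at h
  have h1b : Derivable ℂ (2 ^ k) A {v | ∃ i < 2 ^ k, v = wb i} := by
    refine polyMulCost_family fun i hi => ?_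
    have h := Derivable.smul (k := ℂ) (A := A) (hb i hi) (η ^ i)
    rwa [Algebra.smul_def, map_pow] at h
  have h1 := h1a.union h1b
  -- stage 2: two forward FFTs with `ω = η²`, `k 2^k + k 2^k` steps
  have h2a : Derivable ℂ (k * 2 ^ k) (A ∪ ({v | ∃ i < 2 ^ k, v = wa i} ∪ {v | ∃ i < 2 ^ k, v = wb i}))
      {v | ∃ j < 2 ^ k, v = fft k (algebraMap ℂ K η * algebraMap ℂ K η) wa j} := by
    have h := hfft k (η * η) wa (A ∪ ({v | ∃ i < 2 ^ k, v = wa i} ∪ {v | ∃ i < 2 ^ k, v = wb i}))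
      (fun i hi => Or.inl (Or.inr (Or.inl ⟨i, hi, rfl⟩)))
    rwa [map_mul] at h
  have h2b : Derivable ℂ (k * 2 ^ k) (A ∪ ({v | ∃ i < 2 ^ k, v = wa i} ∪ {v | ∃ i < 2 ^ k, v = wb i}))
      {v | ∃ j < 2 ^ k, v = fft k (algebraMap ℂ K η * algebraMap ℂ K η) wb j} := by
    have h := hfft k (η * η) wb (A ∪ ({v | ∃ i < 2 ^ k, v = wa i} ∪ {v | ∃ i < 2 ^ k, v = wb i}))
      (fun i hi => Or.inl (Or.inr (Or.inr ⟨i, hi, rfl⟩)))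
    rwa [map_mul] at h
  have h2 := h2a.union h2b
  -- stage 3: the pointwise products, `2^k` steps
  have h3 : Derivable ℂ (2 ^ k)
      (A ∪ ({v | ∃ i < 2 ^ k, v = wa i} ∪ {v | ∃ i < 2 ^ k, v = wb i}) ∪
        ({v | ∃ j < 2 ^ k, v = fft k (algebraMap ℂ K η * algebraMap ℂ K η) wa j} ∪
          {v | ∃ j < 2 ^ k, v = fft k (algebraMap ℂ K η * algebraMap ℂ K η) wb j}))
      {v | ∃ l < 2 ^ k, v = P l} := by
    refine polyMulCost_family fun l hl => ?_
    exact Derivable.mul (k := ℂ) (Or.inl (Or.inr (Or.inl ⟨l, hl, rfl⟩)))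
      (Or.inl (Or.inr (Or.inr ⟨l, hl, rfl⟩)))
  -- stage 4: the backward FFT, `k 2^k` steps
  have h4 : Derivable ℂ (k * 2 ^ k)
      (A ∪ ({v | ∃ i < 2 ^ k, v = wa i} ∪ {v | ∃ i < 2 ^ k, v = wb i}) ∪
        ({v | ∃ j < 2 ^ k, v = fft k (algebraMap ℂ K η * algebraMap ℂ K η) wa j} ∪
          {v | ∃ j < 2 ^ k, v = fft k (algebraMap ℂ K η * algebraMap ℂ K η) wb j}) ∪
        {v | ∃ l < 2 ^ k, v = P l})
      {v | ∃ j < 2 ^ k, v = fft k (algebraMap ℂ K η * algebraMap ℂ K η) P j} := by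
    have h := hfft k (η * η) P
      (A ∪ ({v | ∃ i < 2 ^ k, v = wa i} ∪ {v | ∃ i < 2 ^ k, v = wb i}) ∪
        ({v | ∃ j < 2 ^ k, v = fft k (algebraMap ℂ K η * algebraMap ℂ K η) wa j} ∪
          {v | ∃ j < 2 ^ k, v = fft k (algebraMap ℂ K η * algebraMap ℂ K η) wb j}) ∪
        {v | ∃ l < 2 ^ k, v = P l})
      (fun l hl => Or.inl (Or.inr ⟨l, hl, rfl⟩))
    rwa [map_mul] at h
  -- stage 5: unweighting, reversal and division by `2^k`, `2^k` linear steps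
  have h5 : Derivable ℂ (2 ^ k)
      (A ∪ ({v | ∃ i < 2 ^ k, v = wa i} ∪ {v | ∃ i < 2 ^ k, v = wb i}) ∪
        ({v | ∃ j < 2 ^ k, v = fft k (algebraMap ℂ K η * algebraMap ℂ K η) wa j} ∪
          {v | ∃ j < 2 ^ k, v = fft k (algebraMap ℂ K η * algebraMap ℂ K η) wb j}) ∪
        {v | ∃ l < 2 ^ k, v = P l} ∪
        {v | ∃ j < 2 ^ k, v = fft k (algebraMap ℂ K η * algebraMap ℂ K η) P j})
      {w | ∃ m < 2 ^ k, w = fastNconv k (algebraMap ℂ K η) (algebraMap ℂ K c) a b m} := by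
    refine polyMulCost_family fun m hm => ?_
    have hidx : (2 ^ k - m) % 2 ^ k < 2 ^ k := Nat.mod_lt _ (by positivity)
    have h := Derivable.smul (k := ℂ)
      (A := A ∪ ({v | ∃ i < 2 ^ k, v = wa i} ∪ {v | ∃ i < 2 ^ k, v = wb i}) ∪
        ({v | ∃ j < 2 ^ k, v = fft k (algebraMap ℂ K η * algebraMap ℂ K η) wa j} ∪
          {v | ∃ j < 2 ^ k, v = fft k (algebraMap ℂ K η * algebraMap ℂ K η) wb j}) ∪
        {v | ∃ l < 2 ^ k, v = P l} ∪
        {v | ∃ j < 2 ^ k, v = fft k (algebraMap ℂ K η * algebraMap ℂ K η) P j})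
      (x := fft k (algebraMap ℂ K η * algebraMap ℂ K η) P ((2 ^ k - m) % 2 ^ k))
      (Or.inl (Or.inr ⟨_, hidx, rfl⟩)) (c * η ^ (2 * 2 ^ k - m))
    rw [Algebra.smul_def, map_mul, map_pow] at h
    exact h
  have chain := h1.trans (h2.trans (h3.trans (h4.trans h5)))
  exact chain.mono (le_of_eq (by ring)) le_rfl le_rfl

/-- **Stub `polyMulCost`** — see `Lines/Sketch.lean`. [cite: GathenGerhard2013, §8.3 Thm 8.22] -/
theorem stub_polyMulCost (hfft : ∀ (κ : ℕ) (ω : ℂ) (a : ℕ → K) (A : Set K),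
      (∀ i < 2 ^ κ, a i ∈ A ∪ Set.range (algebraMap ℂ K)) →
      Derivable ℂ (κ * 2 ^ κ) A {v | ∃ j < 2 ^ κ, v = fft κ (algebraMap ℂ K ω) a j}) :
    ∀ (n : ℕ) (u v : Fin n → K) (A : Set K),
      (∀ i, u i ∈ A ∪ Set.range (algebraMap ℂ K)) → (∀ i, v i ∈ A ∪ Set.range (algebraMap ℂ K)) →
      Derivable ℂ (16 * n * (Nat.log 2 n + 4)) A
        {w | ∃ m : ℕ, w = ∑ i : Fin n, ∑ j : Fin n, if (i : ℕ) + j = m then u i * v j else 0} := by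
  intro n u v A hu hv
  rcases Nat.eq_zero_or_pos n with rfl | hn
  · -- no coefficients: every target is the empty sum `0`, a constant
    refine Derivable.of_subset ?_ _
    rintro w ⟨m, rfl⟩
    exact Or.inr ⟨0, by simp⟩
  -- the padding length `2 ^ (log₂ n + 2) ∈ [2n, 4n]`
  have hlt : n < 2 ^ Nat.log 2 n * 2 := by
    have h := Nat.lt_pow_succ_log_self one_lt_two n
    rwa [pow_succ] at h
  have hle : 2 ^ Nat.log 2 n ≤ n := Nat.pow_log_le_self 2 hn.ne'
  have ht : 2 ^ (Nat.log 2 n + 2) = 2 ^ Nat.log 2 n * 4 := by rw [pow_add]; norm_num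
  have ht2n : 2 * n ≤ 2 ^ (Nat.log 2 n + 2) := by rw [ht]; omega
  have ht4n : 2 ^ (Nat.log 2 n + 2) ≤ 4 * n := by rw [ht]; omega
  -- the inputs, extended by zero to sequences on `ℕ`
  obtain ⟨a, hau, ha0⟩ : ∃ a : ℕ → K, (∀ i : Fin n, a i = u i) ∧ ∀ i, n ≤ i → a i = 0 :=
    ⟨fun i => if h : i < n then u ⟨i, h⟩ else 0, fun i => by simp, fun i hi => by
      simp [not_lt.2 hi]⟩
  obtain ⟨b, hbv, hb0⟩ : ∃ b : ℕ → K, (∀ i : Fin n, b i = v i) ∧ ∀ i, n ≤ i → b i = 0 :=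
    ⟨fun i => if h : i < n then v ⟨i, h⟩ else 0, fun i => by simp, fun i hi => by
      simp [not_lt.2 hi]⟩
  have hmem : ∀ (f : ℕ → K) (g : Fin n → K), (∀ i : Fin n, f i = g i) → (∀ i, n ≤ i → f i = 0) →
      (∀ i, g i ∈ A ∪ Set.range (algebraMap ℂ K)) →
      ∀ i < 2 ^ (Nat.log 2 n + 2), f i ∈ A ∪ Set.range (algebraMap ℂ K) := by
    intro f g hfg hf0 hg i _
    rcases Nat.lt_or_ge i n with hi | hi
    · have e : f i = g ⟨i, hi⟩ := hfg ⟨i, hi⟩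
      rw [e]
      exact hg _
    · exact Or.inr ⟨0, by rw [hf0 i hi, map_zero]⟩
  -- a root of unity `η` of order `2 ^ (log₂ n + 3)` and the constant `1 / 2 ^ (log₂ n + 2)`
  obtain ⟨η, hηt⟩ : ∃ η : ℂ, η ^ 2 ^ (Nat.log 2 n + 2) = -1 :=
    ⟨Complex.exp (Real.pi * Complex.I / ((2 ^ (Nat.log 2 n + 2) : ℕ) : ℂ)), by
      rw [← Complex.exp_nat_mul, mul_div_cancel₀ _
        (Nat.cast_ne_zero.2 (pow_ne_zero _ two_ne_zero) : ((2 ^ (Nat.log 2 n + 2) : ℕ) : ℂ) ≠ 0)]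
      exact Complex.exp_pi_mul_I⟩
  have hηK : (algebraMap ℂ K η) ^ 2 ^ (Nat.log 2 n + 2) = -1 := by
    rw [← map_pow, hηt, map_neg, map_one]
  obtain ⟨c, hc⟩ : ∃ c : ℂ, algebraMap ℂ K c * ((2 ^ (Nat.log 2 n + 2) : ℕ) : K) = 1 :=
    ⟨((2 ^ (Nat.log 2 n + 2) : ℕ) : ℂ)⁻¹, by
      rw [← map_natCast (algebraMap ℂ K) (2 ^ (Nat.log 2 n + 2)), ← map_mul,
        inv_mul_cancel₀ (Nat.cast_ne_zero.2 (pow_ne_zero _ two_ne_zero)), map_one]⟩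
  -- the cost of all `fastNconv` outputs
  have hcost := polyMulCost_fastNconvCost hfft (Nat.log 2 n + 2) η c a b A (hmem a u hau ha0 hu)
    (hmem b v hbv hb0 hv)
  -- identification of the targets: `fastNconv = nconv =` the plain product (no wrap-around)
  have key : ∀ m < 2 ^ (Nat.log 2 n + 2),
      (∑ i : Fin n, ∑ j : Fin n, if (i : ℕ) + j = m then u i * v j else 0) =
        fastNconv (Nat.log 2 n + 2) (algebraMap ℂ K η) (algebraMap ℂ K c) a b m := by
    intro m hm
    rw [fastNconv_eq_nconv hηK hc a b hm, polyMulCost_sum_fin_eq n u v a b hau hbv m]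
    exact polyMulCost_coeff_eq_nconv ht2n a b ha0 hb0 m
  have hzero : ∀ m, 2 ^ (Nat.log 2 n + 2) ≤ m →
      (∑ i : Fin n, ∑ j : Fin n, if (i : ℕ) + j = m then u i * v j else 0) = 0 := by
    intro m hm
    refine Finset.sum_eq_zero fun i _ => Finset.sum_eq_zero fun j _ => if_neg ?_
    have := i.is_lt
    have := j.is_lt
    omega
  refine Derivable.mono (hcost.trans (Derivable.of_subset
    (B := {w | ∃ m : ℕ, w = ∑ i : Fin n, ∑ j : Fin n, if (i : ℕ) + j = m then u i * v j else 0})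
    ?_ 0)) ?_ le_rfl le_rfl
  · rintro w ⟨m, rfl⟩
    rcases Nat.lt_or_ge m (2 ^ (Nat.log 2 n + 2)) with hm | hm
    · exact Or.inl (Or.inr ⟨m, hm, key m hm⟩)
    · exact Or.inr ⟨0, by rw [map_zero, hzero m hm]⟩
  · calc (3 * (Nat.log 2 n + 2) + 4) * 2 ^ (Nat.log 2 n + 2) + 0
        ≤ (3 * (Nat.log 2 n + 2) + 4) * (4 * n) :=
          (Nat.add_zero _).trans_le (Nat.mul_le_mul_left _ ht4n)
      _ ≤ 4 * (Nat.log 2 n + 4) * (4 * n) := Nat.mul_le_mul_right _ (by omega)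
      _ = 16 * n * (Nat.log 2 n + 4) := by ring

end KLevel

end

end Summit.MatrixMultiplication.MatrixMultiplication.Theorems
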